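import Mathlib.Tactic.Linarith
import Mathlib.Tactic.NormNum
import Mathlib.Tactic.Ring
import HarnessLib

/-!
# The (0,1) cell of the ι-window, XXXVIII (companion C): the product ground `B₁ × B₂`, XXV — THE CORNER X, ADDENDUM 2
# (report [XXXVIII] `H2-ZERO-ONE-38.md` §11): arithmetic shadows of COROLLARY H′-ZERO-ROWS (the ten h′ = 0 open cells of RB-22 types 2 and 5)

Family `hodge`, b2b cell `hweil` (helper of item stmt-HodgeConjecture-2524). Report
`run/shared/lean/b2b/hodge-weil/b2b-hweil-pv1-g50/H2-ZERO-ONE-38.md` ([XXXVIII]) §11 (ADDENDUM 2). Context (the report's words, nothing of them formalised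
here): THEOREM H′-ZERO's mechanism (off-S skeleton = fixed fibres + at most one theta translate; fat theta structure capped by the crossing identity; β-budget
on the theta structure alone when `h′ = 0`) is row-independent; in the other rows of (Q-RES) the open `h′ = 0` cells are the five cells `(8, d₃, 25, d₃)`,
`d₃ = 12…16`, of RB-22 type 2 (`(n′, m′, μ′) = (12, 100, 86)`, `n₃ = 8`, `ρ = 4`, `W′·f′ = 36`, `v′ = 9`, `W′·S/2 = 54 + 4d₃`) and the five cells
`(9, d₃, 29, d₃)`, `d₃ = 14…18`, of type 5 (`(14, 134, 114)`, `n₃ = 9`, `ρ = 4`, `W′·f′ = 44`, `v′ = 11`, `W′·S/2 = 78 + 4d₃`); in each `4v′ = W′·f′`, so the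
Ω-bracket `(d₃ − 3)(W′·f′/2 − P)` with `P ≤ 2v′` is non-negative in every configuration, THETA-CAP gives `m_h ≤ 1 + ⌊(2(ρ + 1) + W′·f′)/8⌋ = 6` resp. `7`, and the
β-budget `m_h = W′·S/2 ≥ 102` resp. `≥ 134` is contradicted (COROLLARY H′-ZERO-ROWS). The theorems below are the integer identities and inequalities behind these
statements. None of them claims geometry. HONEST FRAMING: census work inside the ladder's H2 test ((0,1) cell) on the SPECIAL fourfold `X₀`; nothing here is a
rung; no case of the Hodge conjecture is proved; no statement of [Markman 2025] / [Perry 2026] / [EdGFS 2025] is used.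
-/

-- mandated namespace `Summit.HodgeConjecture.HodgeConjecture.…` (Problem = Summit) trips `linter.dupNamespace`; the lakefile disables it
-- tree-wide (weak option), restated here so stand-alone elaboration is warning-free too.
set_option linter.dupNamespace false

namespace Summit.HodgeConjecture.HodgeConjecture.WeilTypeLadder

section ProductGroundTwentyFiveC

/-- **[XXXVIII] 11.1 (COROLLARY H′-ZERO-ROWS, the cycle numbers).** `W′·f′ = m′ − 2n₃n₄`, `W′·S/2 = μ′ − n₃d₄ − n₄d₃` with `n₄ = n′ − n₃`, `d₄ = 4 − d₃`,
`ρ = 2n₃ − n′`, `v′ = a₁ − 2n₃`: RB-22 type 2 (`n′ = 12`, `m′ = 100`, `μ′ = 86`, `n₃ = 8`, `a₁ = 25`): `ρ = 4`, `W′·f′ = 36 = 4v′`, `W′·S/2 = 54 + 4d₃`;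
type 5 (`n′ = 14`, `m′ = 134`, `μ′ = 114`, `n₃ = 9`, `a₁ = 29`): `ρ = 4`, `W′·f′ = 44 = 4v′`, `W′·S/2 = 78 + 4d₃`; both satisfy `2n₃ ≥ n′ + 3`. [`norm_num`, `ring`] -/
theorem pg25c_rows_cycle_numbers :
    ((2 : ℤ) * 8 - 12 = 4 ∧ (100 : ℤ) - 2 * 8 * (12 - 8) = 36 ∧ (4 : ℤ) * (25 - 2 * 8) = 36 ∧ (12 : ℤ) + 3 ≤ 2 * 8 ∧
      ∀ d₃ : ℤ, 86 - 8 * (4 - d₃) - (12 - 8) * d₃ = 54 + 4 * d₃) ∧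
    ((2 : ℤ) * 9 - 14 = 4 ∧ (134 : ℤ) - 2 * 9 * (14 - 9) = 44 ∧ (4 : ℤ) * (29 - 2 * 9) = 44 ∧ (14 : ℤ) + 3 ≤ 2 * 9 ∧
      ∀ d₃ : ℤ, 114 - 9 * (4 - d₃) - (14 - 9) * d₃ = 78 + 4 * d₃) := by
  refine ⟨⟨by norm_num, by norm_num, by norm_num, by norm_num, fun d₃ => by ring⟩,
    ⟨by norm_num, by norm_num, by norm_num, by norm_num, fun d₃ => by ring⟩⟩

/-- **[XXXVIII] 11.1 (COROLLARY H′-ZERO-ROWS, the bracket and the cap).** At `ρ = 4` the Ω-bracket of the LEDGER is `(d₃ − 3)(W′·f′/2 − P)` with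
`P ≤ 2v′`; when `4v′ = W′·f′` it is `≥ 0` in every configuration. THETA-CAP with `Λ ≤ W′·f′` (fibres only): `8(m_h − 1) ≤ 2(ρ + 1) + W′·f′` gives `m_h ≤ 6`
(`W′·f′ = 36`) and `m_h ≤ 7` (`W′·f′ = 44`). [`nlinarith`, `omega`] -/
theorem pg25c_rows_bracket_and_cap :
    (∀ d₃ wf P v : ℤ, 3 ≤ d₃ → P ≤ 2 * v → 4 * v = wf → 0 ≤ (d₃ - 3) * (wf - 2 * P)) ∧
    (∀ m : ℤ, 8 * (m - 1) ≤ 2 * (4 + 1) + 36 → m ≤ 6) ∧ (∀ m : ℤ, 8 * (m - 1) ≤ 2 * (4 + 1) + 44 → m ≤ 7) := by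
  refine ⟨?_, fun m h => by omega, fun m h => by omega⟩
  intro d₃ wf P v hd hP hv
  have h1 : 0 ≤ d₃ - 3 := by omega
  have h2 : 0 ≤ wf - 2 * P := by omega
  exact mul_nonneg h1 h2

/-- **[XXXVIII] 11.1 (COROLLARY H′-ZERO-ROWS, the contradiction).** `h′ = 0` (every S-component a vertical fibre, `β = 0`) and the OFF-S skeleton put the
β-budget on the theta structure: `m_h = W′·S/2`; type 2: `54 + 4d₃ ≥ 102` (`d₃ ≥ 12`) against `m_h ≤ 6`; type 5: `78 + 4d₃ ≥ 134` (`d₃ ≥ 14`) against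
`m_h ≤ 7`. The residual counts: type 2: `72 − 5 = 67`; type 5: `82 − 5 = 77`. [`omega`, `norm_num`] -/
theorem pg25c_rows_h_prime_zero_void :
    (∀ d₃ m : ℤ, 12 ≤ d₃ → m = 54 + 4 * d₃ → m ≤ 6 → False) ∧ (∀ d₃ m : ℤ, 14 ≤ d₃ → m = 78 + 4 * d₃ → m ≤ 7 → False) ∧
    ((72 : ℕ) - 5 = 67 ∧ (82 : ℕ) - 5 = 77 ∧ (65 : ℕ) - 5 = 60) := by
  refine ⟨fun d₃ m h1 h2 h3 => by omega, fun d₃ m h1 h2 h3 => by omega, by norm_num⟩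

end ProductGroundTwentyFiveC

end Summit.HodgeConjecture.HodgeConjecture.WeilTypeLadder
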